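import Summits.CriticalPhenomena.PercolationContinuityZ3.Theorems.PercNearOneGluingNoHeavyLowerTailMajorityGluingQCertSymPerm
import HarnessLib

/-!
# «At least `h` of `k` relays cut» from ANY passing symmetrised certificate (lane prim-rate, constants-miner 1, gen 36; CANDIDATES §GEN-36, NEXT-g37)

Support file for the closed crux `NoHeavyLowerTail` (stmt-CriticalPhenomena-4575), majority-gluing line.  The counting theorem of the orbit-key
certificate machine `…MajorityGluingQCertSym`: the family of points is the family of cut laws `lawFam w a₀ t δ g = lawvK w a₀ (t ∘ g) δ` of ALL `k!`
relabellings of an enumeration `t` of the `k`-set `T` — each satisfies the marginal hypotheses and every well-formed van den Berg–Kahn row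
(`row_lawvK`), all share `v_g(D) = δ` and `T(v_g) = μ(h ≤ #cut T)`, and the key valuation `valS` has the orbit property (`valS_keyS`) — so the abstract
soundness `SymCert.soundS` applies (`cut_of_posS` / `cut_of_posS_count` in evaluation form, for certificates checked in parts): **`cut_of_checkS_count`**: if `c.checkS fuel = true` and `c.base.m = k`, then for every finite weighted graph, hub `a₀`,
`k`-set `T` and `δ ≥ 0` bounding the cut probabilities on `T`, `cD·μ(c.base.h ≤ #{v ∈ T : v ↮ a₀}) ≤ cN·δ`.  A symmetrised certificate for any cell thus
lands as data + one `decide +kernel` + an instantiation of this theorem.  No sorries. [cite: VandenbergKahn2001, Thm 1.2 (p. 123)]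
-/

noncomputable section

namespace Summit.CriticalPhenomena.PercolationContinuityZ3.Theorems

open MeasureTheory Set
open Literature.Probability.LatticeModels (prodBernoulli)
open Literature.Probability.Percolation
open scoped Classical

namespace HubOnly
namespace QCert

variable {n k : ℕ}

namespace SymCert

variable (c : SymCert) (hm : c.base.m = k)
include hm

/-- **«At least `h` of `k` cut» along an enumeration, evaluation form:** a structurally sound symmetrised certificate whose contribution list
evaluates nonnegatively at every nonnegative key valuation gives `cD·μ(c.base.h ≤ #cut T) ≤ cN·δ`. [cite: VandenbergKahn2001, Thm 1.2 (p. 123)] -/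
theorem cut_of_posS (hWS : c.checkWS = true) (hpos : ∀ val : ℕ → ℝ, (∀ key, 0 ≤ val key) → 0 ≤ evalC val c.contribsS)
    (w : Sym2 (Fin n) → unitInterval) (a₀ : Fin n) (t : Fin k → Fin n)
    (ht : Function.Injective t) (T : Finset (Fin n)) (hT : T = Finset.univ.image t)
    (δ : ℝ) (hδ0 : 0 ≤ δ) (hδ : ∀ x : Fin k, (prodBernoulli w).real (openConn a₀ (t x) : Set (BondConfig (Fin n)))ᶜ ≤ δ) :
    (c.base.cD : ℝ) * (prodBernoulli w).real
        {ω : BondConfig (Fin n) | c.base.h ≤ (T.filter fun x => ω ∉ (openConn a₀ x : Set (BondConfig (Fin n)))).card} ≤ c.base.cN * δ := by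
  have hNV : c.NV = 2 ^ k + 1 := by rw [SymCert.NV, Cert.NV, hm]
  have hD : c.base.D = 2 ^ k := by rw [Cert.D, hm]
  obtain ⟨_, _, _, _, _, hrowsOK⟩ := c.checkWS_spec hWS
  set v := lawFam w a₀ t δ with hv_def
  have hv : ∀ g i, 0 ≤ v g i := fun g i => lawvK_nonneg w a₀ (t ∘ g) δ hδ0 i
  have htg : ∀ g : Equiv.Perm (Fin k), Function.Injective (t ∘ ⇑g) := fun g => ht.comp g.injective
  have hTg : ∀ g : Equiv.Perm (Fin k), T = Finset.univ.image (t ∘ ⇑g) := fun g => by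
    rw [← Finset.image_image, Finset.image_univ_of_surjective g.surjective, hT]
  exact c.soundS_of_nonneg hWS v hv (valS v (2 ^ k + 1)) (hpos _ (valS_nonneg v hv _))
    (by
      intro i hi j hj
      rw [hNV] at hi hj
      rw [SymCert.key, hm]
      exact valS_keyS w a₀ t δ i j hi hj)
    δ _ (fun g => by rw [hD]; exact lawvK_D w a₀ (t ∘ g) δ)
    (fun g => by
      show linv c.NV (fun i => Cert.bi (c.base.tMem i)) (lawvK w a₀ (t ∘ ⇑g) δ) = _
      rw [hNV, linv_lawvK _ _ _ _ _ (tMemK_D c.base hm), setOf_tMemK c.base hm a₀ (t ∘ ⇑g) (htg g) T (hTg g)])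
    (by
      intro g x hx
      rw [hm] at hx
      show linv c.NV (fun i => Cert.bi (c.base.margMem x i)) (lawvK w a₀ (t ∘ ⇑g) δ) ≤ lawvK w a₀ (t ∘ ⇑g) δ c.base.D
      rw [hNV, hD, lawvK_D, linv_lawvK _ _ _ _ _ (margMemK_D c.base hm x), setOf_margMemK c.base hm a₀ (t ∘ ⇑g) ⟨x, hx⟩]
      exact hδ (g ⟨x, hx⟩))
    (by
      intro g ch hch r hr
      show linv c.NV _ (lawvK w a₀ (t ∘ ⇑g) δ) * linv c.NV _ (lawvK w a₀ (t ∘ ⇑g) δ) ≤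
        linv c.NV _ (lawvK w a₀ (t ∘ ⇑g) δ) * linv c.NV _ (lawvK w a₀ (t ∘ ⇑g) δ)
      rw [hNV]
      exact row_lawvK c.base hm w a₀ (t ∘ ⇑g) (htg g) δ r (hrowsOK ch hch r hr))

/-- **«At least `h` of `k` cut» along an enumeration, for ANY passing symmetrised certificate:** `cD·μ(c.base.h ≤ #cut T) ≤ cN·δ`.
[cite: VandenbergKahn2001, Thm 1.2 (p. 123)] -/
theorem cut_of_checkS (fuel : ℕ) (hc : c.checkS fuel = true) (w : Sym2 (Fin n) → unitInterval) (a₀ : Fin n) (t : Fin k → Fin n)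
    (ht : Function.Injective t) (T : Finset (Fin n)) (hT : T = Finset.univ.image t)
    (δ : ℝ) (hδ0 : 0 ≤ δ) (hδ : ∀ x : Fin k, (prodBernoulli w).real (openConn a₀ (t x) : Set (BondConfig (Fin n)))ᶜ ≤ δ) :
    (c.base.cD : ℝ) * (prodBernoulli w).real
        {ω : BondConfig (Fin n) | c.base.h ≤ (T.filter fun x => ω ∉ (openConn a₀ x : Set (BondConfig (Fin n)))).card} ≤ c.base.cN * δ := by
  have hWQ : c.checkWS = true ∧ c.checkQS fuel = true := by
    unfold checkS at hc; simpa only [Bool.and_eq_true] using hc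
  exact c.cut_of_posS hm hWQ.1 (fun val hval => evalC_nonneg_of_runsOK_msort2 _ hval fuel _ hWQ.2) w a₀ t ht T hT δ hδ0 hδ

/-- **Counting form of the evaluation version** (orientation `v ↮ a₀`; `|T| = k`). [cite: VandenbergKahn2001, Thm 1.2 (p. 123)] -/
theorem cut_of_posS_count (hWS : c.checkWS = true) (hpos : ∀ val : ℕ → ℝ, (∀ key, 0 ≤ val key) → 0 ≤ evalC val c.contribsS)
    (w : Sym2 (Fin n) → unitInterval) (a₀ : Fin n) (T : Finset (Fin n))
    (hT : T.card = k) (δ : ℝ) (hδ0 : 0 ≤ δ) (hδ : ∀ v ∈ T, (prodBernoulli w).real (openConn v a₀ : Set (BondConfig (Fin n)))ᶜ ≤ δ) :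
    (c.base.cD : ℝ) * (prodBernoulli w).real {ω : BondConfig (Fin n) | c.base.h ≤ (T.filter fun v => ω ∉ openConn v a₀).card} ≤
      c.base.cN * δ := by
  have hδ' : ∀ x ∈ T, (prodBernoulli w).real (openConn a₀ x : Set (BondConfig (Fin n)))ᶜ ≤ δ := by
    intro x hx; rw [knThm2_openConn_comm]; exact hδ x hx
  have hset : {ω : BondConfig (Fin n) | c.base.h ≤ (T.filter fun v => ω ∉ openConn v a₀).card} =
      {ω : BondConfig (Fin n) | c.base.h ≤ (T.filter (fun x => ω ∉ (openConn a₀ x : Set (BondConfig (Fin n))))).card} := by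
    ext ω
    simp only [mem_setOf_eq]
    rw [Finset.filter_congr (fun v _ => by rw [knThm2_openConn_comm v a₀])]
  rw [hset]
  obtain ⟨t, ht, hTt, _⟩ := exists_sorted_enumK T hT (fun _ => (0 : ℝ))
  exact c.cut_of_posS hm hWS hpos w a₀ t ht T hTt δ hδ0 fun x =>
    hδ' (t x) (by rw [hTt]; exact Finset.mem_image_of_mem _ (Finset.mem_univ _))

/-- **«AT LEAST `h` OF `k` RELAYS CUT» FOR ANY PASSING SYMMETRISED CERTIFICATE, counting form** (orientation `v ↮ a₀`; `|T| = k`; `δ ≥ 0` bounds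
the `k` cut probabilities): `cD·μ(c.base.h ≤ #{v ∈ T : v ↮ a₀}) ≤ cN·δ`. [cite: VandenbergKahn2001, Thm 1.2 (p. 123)] -/
theorem cut_of_checkS_count (fuel : ℕ) (hc : c.checkS fuel = true) (w : Sym2 (Fin n) → unitInterval) (a₀ : Fin n) (T : Finset (Fin n))
    (hT : T.card = k) (δ : ℝ) (hδ0 : 0 ≤ δ) (hδ : ∀ v ∈ T, (prodBernoulli w).real (openConn v a₀ : Set (BondConfig (Fin n)))ᶜ ≤ δ) :
    (c.base.cD : ℝ) * (prodBernoulli w).real {ω : BondConfig (Fin n) | c.base.h ≤ (T.filter fun v => ω ∉ openConn v a₀).card} ≤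
      c.base.cN * δ := by
  have hWQ : c.checkWS = true ∧ c.checkQS fuel = true := by
    unfold checkS at hc; simpa only [Bool.and_eq_true] using hc
  exact c.cut_of_posS_count hm hWQ.1 (fun val hval => evalC_nonneg_of_runsOK_msort2 _ hval fuel _ hWQ.2) w a₀ T hT δ hδ0 hδ

end SymCert

/-! ### Smoke test through the whole chain: `(2,1)` at `c = 2` (the trivial certificate `symSmoke`) -/

/-- **End-to-end smoke test:** from the trivial passing certificate `symSmoke`, `μ(1 ≤ #cut of 2 relays) ≤ 2δ`. -/
theorem oneOfTwo_symSmoke (w : Sym2 (Fin n) → unitInterval) (a₀ : Fin n) (T : Finset (Fin n)) (hT : T.card = 2) (δ : ℝ) (hδ0 : 0 ≤ δ)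
    (hδ : ∀ v ∈ T, (prodBernoulli w).real (openConn v a₀ : Set (BondConfig (Fin n)))ᶜ ≤ δ) :
    (prodBernoulli w).real {ω : BondConfig (Fin n) | 1 ≤ (T.filter fun v => ω ∉ openConn v a₀).card} ≤ 2 * δ := by
  have h := SymCert.cut_of_checkS_count symSmoke rfl 8 symSmoke_check w a₀ T hT δ hδ0 hδ
  have hcD : (symSmoke.base.cD : ℝ) = 1 := by norm_num [symSmoke]
  have hcN : (symSmoke.base.cN : ℝ) = 2 := by norm_num [symSmoke]
  have hh : symSmoke.base.h = 1 := rfl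
  rw [hcD, hcN, hh] at h
  linarith

end QCert
end HubOnly

end Summit.CriticalPhenomena.PercolationContinuityZ3.Theorems

end
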